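import Literature.Analysis.FluidPDE.PeriodicLerayMollifiedDrift
import Literature.Analysis.FluidPDE.MollifiedLerayDistributional
import Literature.Analysis.FluidPDE.NSWeakStrongUniquenessProofs
import Literature.Analysis.FluidPDE.CKNTenThirdsInterpolation
import Literature.Analysis.FluidPDE.WeakGradientSlicing
import Literature.Analysis.FluidPDE.MollifiedField
import Literature.Analysis.FluidPDE.MollifiedSolenoidalTest
import HarnessLib

/-!
# [BT1] the classes of the unknown, of the profile and of the mollified drift

Analysis/FluidPDE proof file (theorems only; no definitions, no named facts) in the DAG below the
named fact `Literature.Analysis.FluidPDE.bradshawTsai2017_thm_2_4_mollified`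
(`PeriodicLerayExistence.lean`; Bradshaw–Tsai, Ann. Henri Poincaré 18 (2017) = arXiv:1510.07504
[BT1], proof of Thm 2.4). The proof of Thm 2.4 uses, for the periodic weak solution `U = U_ε` of
the mollified perturbed Leray system (energy class `L^∞(0,T;L²) ∩ L²(0,T;H¹)`, `T`-periodic),
for the revised profile `W` of Lemma 2.5 and for the mollified drift `η_ε * U`:

* "`U_ε` … in `L^{10/3}(ℝ³ × [0,T])`" — the multiplicative inequality
  `‖U‖_{L^{10/3}(ℝ³×(0,T))}^{10/3} ≤ c ‖U‖_{L^∞L²}^{4/3} ‖∇U‖²_{L²L²}` (Gagliardo–Nirenberg–Sobolev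
  slice by slice and Hölder), here for fields with a weak spatial gradient
  (`lintegral_period_tenThirds_le`, with the explicit `ε`-independent bound
  `C^{2/3} K² C`, `K` Mathlib's Sobolev constant), and the slab classes `L^{10/3}([a,b] × ℝ³)`
  by periodicity (`memLp_slab_tenThirds`);
* "`‖W‖_{L^{10/3}(ℝ³×[0,T])}`" finite: `∫∫_{(0,T)×ℝ³} |W|^{10/3} ≤ T α^{10/3}`
  (`lintegral_period_profile_le`) and the slab classes of `W` (`memLp_slab_profile`);
* the mollified drift `V = η_ε * U`: `T`-periodic, jointly measurable, Young's inequality on time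
  slabs `∫∫_{I×ℝ³} |η_ε * U|^q ≤ ‖η‖₁^q ∫∫_{I×ℝ³} |U|^q` (`lintegral_slab_mollify_rpow_le`), the
  slab classes (`memLp_slab_mollify`), the pointwise bound `|η_ε * U(s)| ≤ ‖η_ε‖₂ ‖U(s)‖₂`
  (`enorm_mollify_le`, `norm_mollify_le_of_energy`), smoothness and divergence-freeness of the
  slices (`contDiff_mollify_slice`, `divergence_mollify_eq_zero`).

These are the integrability inputs of the Riesz pressure (`PeriodicLerayRieszPressure`), of
`BradshawTsai2017.distributional_of_veryWeak_slices` (`MollifiedLerayDistributional`) and of the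
local energy equality of the approximants.

## Mathlib / tree search

Tree (all used): `lintegral_rpow_tenThirds_le_Lp_interpolation` (`CKNTenThirdsInterpolation`),
`eLpNorm_six_le_frobenius_of_hasWeakGradient` (`NSWeakStrongUniquenessProofs`),
`HasWeakSpatialGradientOn.ae_hasWeakFDerivOn_slice` (`WeakGradientSlicing`),
`setLIntegral_Ioo_prod_le_of_periodic`, `IsMollifyingKernel.aestronglyMeasurable_mollify`,
`lintegral_mollify_rpow_le` (`PeriodicLerayCompactness`, `PeriodicLerayMollifiedDrift`),
`enorm_convolution_lsmul_le` (`MollifiedSolenoidalTest`), `divergence_convolution_eq_zero`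
(`MollifiedField`), `memLp_slab_of_forall_eLpNorm_le` (`MollifiedLerayDistributional`).
Mathlib: `HasCompactSupport.contDiff_convolution_left`, `lintegral_prod`,
`AEMeasurable.lintegral_prod_right'`.

## References

* Z. Bradshaw, T.-P. Tsai, Ann. Henri Poincaré 18 (2017) = arXiv:1510.07504, proof of Thm 2.4
  [BradshawTsai2017AHP].
* L. Caffarelli, R. Kohn, L. Nirenberg, Comm. Pure Appl. Math. 35 (1982), §2 (2.8)–(2.9)
  (`L^∞L² ∩ L²H¹ ⊂ L^{10/3}`) [CaffarelliKohnNirenberg1982].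
-/

noncomputable section

open MeasureTheory Set Function Filter Topology TopologicalSpace Metric Module ContinuousLinearMap
open scoped NNReal ENNReal InnerProductSpace RealInnerProductSpace Convolution ContDiff

namespace Literature.Analysis.FluidPDE

namespace BradshawTsai2017

/-! ### Exponent bookkeeping -/

/-- `(10/3 : ℝ≥0∞) ≠ 0`. [folklore] -/
theorem ten_thirds_ne_zero : (10 / 3 : ℝ≥0∞) ≠ 0 :=
  (ENNReal.div_pos (by norm_num) (by norm_num)).ne'

/-- `(10/3 : ℝ≥0∞) ≠ ⊤`. [folklore] -/
theorem ten_thirds_ne_top : (10 / 3 : ℝ≥0∞) ≠ ⊤ :=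
  ENNReal.div_ne_top (by norm_num) (by norm_num)

/-- `(10/3 : ℝ≥0∞).toReal = 10/3`. [folklore] -/
theorem toReal_ten_thirds : (10 / 3 : ℝ≥0∞).toReal = 10 / 3 := by
  rw [ENNReal.toReal_div]; norm_num

/-- `1 ≤ 10/3` in `ℝ≥0∞`. [folklore] -/
theorem one_le_ten_thirds : (1 : ℝ≥0∞) ≤ 10 / 3 := by
  rw [ENNReal.le_div_iff_mul_le (Or.inl (by norm_num)) (Or.inl (by norm_num))]
  norm_num

/-- The restriction of Lebesgue measure to `I × ℝ³` is the product of the restricted time measure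
with Lebesgue measure in space. [folklore] -/
theorem volume_restrict_prod_univ (I : Set ℝ) :
    (volume : Measure (ℝ × EuclideanSpace ℝ (Fin 3))).restrict
        (I ×ˢ (univ : Set (EuclideanSpace ℝ (Fin 3)))) =
      ((volume : Measure ℝ).restrict I).prod (volume : Measure (EuclideanSpace ℝ (Fin 3))) := by
  rw [Measure.volume_eq_prod, ← Measure.restrict_prod_eq_prod_univ]

/-- Almost every slice of a jointly a.e.-strongly measurable field is a.e.-strongly measurable.
[folklore] -/
theorem ae_aestronglyMeasurable_slice {X : Type*} [TopologicalSpace X]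
    [TopologicalSpace.PseudoMetrizableSpace X]
    {U : ℝ → EuclideanSpace ℝ (Fin 3) → X} (hUm : AEStronglyMeasurable (uncurry U) volume) :
    ∀ᵐ s : ℝ, AEStronglyMeasurable (U s) (volume : Measure (EuclideanSpace ℝ (Fin 3))) := by
  have h1 := hUm
  rw [Measure.volume_eq_prod] at h1
  exact h1.prodMk_left

/-! ### `L^∞L² ∩ L²Ḣ¹ ⊂ L^{10/3}` for fields with a weak spatial gradient -/

section TenThirds

variable {T : ℝ} {U : ℝ → EuclideanSpace ℝ (Fin 3) → EuclideanSpace ℝ (Fin 3)}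
  {G : ℝ → EuclideanSpace ℝ (Fin 3) → EuclideanSpace ℝ (Fin 3) →L[ℝ] EuclideanSpace ℝ (Fin 3)}
  {C : ℝ≥0}

/-- `∫ |w|² ≤ C < ∞` and measurability give `w ∈ L²`. [folklore] -/
theorem memLp_two_of_lintegral_sq_le {w : EuclideanSpace ℝ (Fin 3) → EuclideanSpace ℝ (Fin 3)}
    (hw : AEStronglyMeasurable w volume) {C : ℝ≥0} (hC : ∫⁻ y, ‖w y‖ₑ ^ 2 ≤ C) :
    MemLp w 2 (volume : Measure (EuclideanSpace ℝ (Fin 3))) := by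
  refine ⟨hw, (eLpNorm_lt_top_iff_lintegral_rpow_enorm_lt_top two_ne_zero
    ENNReal.ofNat_ne_top).2 ?_⟩
  simp only [ENNReal.toReal_ofNat, ENNReal.rpow_ofNat]
  exact hC.trans_lt ENNReal.coe_lt_top

/-- **The slice inequality `∫ |w|^{10/3} ≤ (∫|w|²)^{2/3} K² ∫|∇w|²`** for `w ∈ L²(ℝ³)` with a
weak gradient `∇w = G_w` of finite Dirichlet energy: Lebesgue interpolation
`∫|w|^{10/3} ≤ (∫|w|²)^{2/3}(∫|w|⁶)^{1/3}` and the Gagliardo–Nirenberg–Sobolev inequality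
`‖w‖₆ ≤ K‖∇w‖₂` (`K` Mathlib's constant `SNormLESNormFDerivOfEqConst`). [cite: CaffarelliKohnNirenberg1982, §2 (2.8)–(2.9)] -/
theorem lintegral_tenThirds_slice_le {w : EuclideanSpace ℝ (Fin 3) → EuclideanSpace ℝ (Fin 3)}
    {Gw : EuclideanSpace ℝ (Fin 3) → EuclideanSpace ℝ (Fin 3) →L[ℝ] EuclideanSpace ℝ (Fin 3)}
    (hw : MemLp w 2 volume) (hG : HasWeakGradient w Gw) :
    ∫⁻ y, ‖w y‖ₑ ^ (10 / 3 : ℝ) ≤ (∫⁻ y, ‖w y‖ₑ ^ 2) ^ (2 / 3 : ℝ) *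
      ((SNormLESNormFDerivOfEqConst (EuclideanSpace ℝ (Fin 3))
          (volume : Measure (EuclideanSpace ℝ (Fin 3))) 2 : ℝ≥0∞) ^ 2 *
        ∫⁻ y, ENNReal.ofReal (frobeniusNormSq (Gw y))) := by
  set Kc : ℝ≥0∞ := (SNormLESNormFDerivOfEqConst (EuclideanSpace ℝ (Fin 3))
    (volume : Measure (EuclideanSpace ℝ (Fin 3))) 2 : ℝ≥0∞) with hKc
  set D : ℝ≥0∞ := ∫⁻ y, ENNReal.ofReal (frobeniusNormSq (Gw y)) with hD
  have hm : AEMeasurable (fun y => ‖w y‖ₑ) (volume : Measure (EuclideanSpace ℝ (Fin 3))) :=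
    hw.1.enorm
  have h1 := lintegral_rpow_tenThirds_le_Lp_interpolation (volume : Measure (EuclideanSpace ℝ (Fin 3))) hm
  refine h1.trans (mul_le_mul' le_rfl ?_)
  have h6 : eLpNorm w 6 volume ≤ Kc * D ^ (1 / 2 : ℝ) :=
    eLpNorm_six_le_frobenius_of_hasWeakGradient (by simp) hw hG
  have e6 : ∫⁻ x, ‖w x‖ₑ ^ (6 : ℝ) = eLpNorm w 6 volume ^ (6 : ℝ) := by
    have h := eLpNorm_natCast_pow_eq_lintegral volume w (n := 6) (by norm_num)
    simp only [Nat.cast_ofNat] at h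
    rw [← ENNReal.rpow_natCast] at h
    simp only [Nat.cast_ofNat] at h
    rw [h]
    refine lintegral_congr fun x => ?_
    rw [← ENNReal.rpow_natCast]
    simp
  rw [e6, ← ENNReal.rpow_mul, show (6 : ℝ) * (1 / 3) = 2 by norm_num]
  calc eLpNorm w 6 volume ^ (2 : ℝ) ≤ (Kc * D ^ (1 / 2 : ℝ)) ^ (2 : ℝ) :=
        ENNReal.rpow_le_rpow h6 (by norm_num)
    _ = Kc ^ 2 * D := by
        rw [ENNReal.mul_rpow_of_nonneg _ _ (by norm_num), ← ENNReal.rpow_mul,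
          show (1 / 2 : ℝ) * 2 = 1 by norm_num, ENNReal.rpow_one]
        simp

/-- **"`U_ε ∈ L^{10/3}(ℝ³ × [0,T])`" with an `ε`-independent bound.** Let `U` be jointly
measurable with a weak spatial gradient `G` on `ℝ × ℝ³`, `∫ |U(s)|² ≤ C` for a.e. `s` and
`∫∫_{(0,T)×ℝ³} |G|² ≤ C`. Then `∫∫_{(0,T)×ℝ³} |U|^{10/3} ≤ C^{2/3} K² C` — the multiplicative
inequality `L^∞L² ∩ L²Ḣ¹ ⊂ L^{10/3}` slice by slice (`lintegral_tenThirds_slice_le`; the slices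
of `G` are weak gradients of the slices of `U` for a.e. time) and Tonelli. [cite: BradshawTsai2017AHP, proof of Thm 2.4 ("U_ε … in L^{10/3}(ℝ³ × [0,T])"); CaffarelliKohnNirenberg1982, §2 (2.8)–(2.9)] -/
theorem lintegral_period_tenThirds_le
    (hUm : AEStronglyMeasurable (uncurry U) volume)
    (hG : HasWeakSpatialGradientOn (⊤ : Opens (ℝ × EuclideanSpace ℝ (Fin 3))) U G)
    (hE : ∀ᵐ s : ℝ, ∫⁻ y, ‖U s y‖ₑ ^ 2 ≤ C)
    (hD : ∫⁻ z in Ioo 0 T ×ˢ (univ : Set (EuclideanSpace ℝ (Fin 3))),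
      ENNReal.ofReal (frobeniusNormSq (G z.1 z.2)) ≤ C) :
    ∫⁻ z in Ioo 0 T ×ˢ (univ : Set (EuclideanSpace ℝ (Fin 3))), ‖U z.1 z.2‖ₑ ^ (10 / 3 : ℝ) ≤
      (C : ℝ≥0∞) ^ (2 / 3 : ℝ) *
        ((SNormLESNormFDerivOfEqConst (EuclideanSpace ℝ (Fin 3))
            (volume : Measure (EuclideanSpace ℝ (Fin 3))) 2 : ℝ≥0∞) ^ 2 * C) := by
  set Kc : ℝ≥0∞ := (SNormLESNormFDerivOfEqConst (EuclideanSpace ℝ (Fin 3))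
    (volume : Measure (EuclideanSpace ℝ (Fin 3))) 2 : ℝ≥0∞) with hKc
  -- the slices of `G` are weak gradients of the slices of `U` for a.e. `t ∈ (0, T)`
  have hGQ : HasWeakSpatialGradientOn
      (⟨Ioo 0 T ×ˢ ((⊤ : Opens (EuclideanSpace ℝ (Fin 3))) : Set (EuclideanSpace ℝ (Fin 3))),
        isOpen_Ioo.prod (⊤ : Opens (EuclideanSpace ℝ (Fin 3))).isOpen⟩ :
        Opens (ℝ × EuclideanSpace ℝ (Fin 3))) U G :=
    hG.mono le_top
  have hsl : ∀ᵐ t ∂(volume.restrict (Ioo 0 T)), HasWeakGradient (U t) (G t) :=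
    hGQ.ae_hasWeakFDerivOn_slice
  have hms : ∀ᵐ t : ℝ, AEStronglyMeasurable (U t) (volume : Measure (EuclideanSpace ℝ (Fin 3))) :=
    ae_aestronglyMeasurable_slice hUm
  -- the slice bound
  have hslice : ∀ᵐ t ∂(volume.restrict (Ioo 0 T)),
      ∫⁻ y, ‖U t y‖ₑ ^ (10 / 3 : ℝ) ≤ (C : ℝ≥0∞) ^ (2 / 3 : ℝ) *
        (Kc ^ 2 * ∫⁻ y, ENNReal.ofReal (frobeniusNormSq (G t y))) := by
    filter_upwards [hsl, ae_restrict_of_ae hms, ae_restrict_of_ae hE] with t h1 h2 h3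
    have hw2 : MemLp (U t) 2 volume := memLp_two_of_lintegral_sq_le h2 h3
    exact (lintegral_tenThirds_slice_le hw2 h1).trans
      (mul_le_mul' (ENNReal.rpow_le_rpow h3 (by norm_num)) le_rfl)
  -- measurability on the slab
  have hprod := volume_restrict_prod_univ (Ioo 0 T)
  have hUa : AEMeasurable (fun z : ℝ × EuclideanSpace ℝ (Fin 3) => ‖U z.1 z.2‖ₑ ^ (10 / 3 : ℝ))
      (((volume : Measure ℝ).restrict (Ioo 0 T)).prod (volume : Measure (EuclideanSpace ℝ (Fin 3)))) := by
    rw [← hprod]; exact hUm.restrict.enorm.pow_const _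
  have hGm : AEStronglyMeasurable (uncurry G) (volume : Measure (ℝ × EuclideanSpace ℝ (Fin 3))) := by
    have h := hG.locallyIntegrableOn_grad.aestronglyMeasurable
    rwa [TopologicalSpace.Opens.coe_top, Measure.restrict_univ] at h
  have hGa : AEMeasurable (fun z : ℝ × EuclideanSpace ℝ (Fin 3) =>
      ENNReal.ofReal (frobeniusNormSq (G z.1 z.2)))
      (((volume : Measure ℝ).restrict (Ioo 0 T)).prod (volume : Measure (EuclideanSpace ℝ (Fin 3)))) := by
    rw [← hprod]
    exact (continuous_frobeniusNormSq'.comp_aestronglyMeasurable hGm.restrict).aemeasurable.ennreal_ofReal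
  rw [hprod] at hD ⊢
  -- Tonelli
  calc ∫⁻ z, ‖U z.1 z.2‖ₑ ^ (10 / 3 : ℝ)
        ∂(((volume : Measure ℝ).restrict (Ioo 0 T)).prod (volume : Measure (EuclideanSpace ℝ (Fin 3))))
      = ∫⁻ t in Ioo 0 T, ∫⁻ y, ‖U t y‖ₑ ^ (10 / 3 : ℝ) := lintegral_prod _ hUa
    _ ≤ ∫⁻ t in Ioo 0 T, (C : ℝ≥0∞) ^ (2 / 3 : ℝ) *
          (Kc ^ 2 * ∫⁻ y, ENNReal.ofReal (frobeniusNormSq (G t y))) := lintegral_mono_ae hslice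
    _ = (C : ℝ≥0∞) ^ (2 / 3 : ℝ) * (Kc ^ 2 *
          ∫⁻ t in Ioo 0 T, ∫⁻ y, ENNReal.ofReal (frobeniusNormSq (G t y))) := by
        rw [lintegral_const_mul'' _ ((hGa.lintegral_prod_right').const_mul _),
          lintegral_const_mul'' _ hGa.lintegral_prod_right']
    _ = (C : ℝ≥0∞) ^ (2 / 3 : ℝ) * (Kc ^ 2 * ∫⁻ z, ENNReal.ofReal (frobeniusNormSq (G z.1 z.2))
        ∂(((volume : Measure ℝ).restrict (Ioo 0 T)).prod (volume : Measure (EuclideanSpace ℝ (Fin 3))))) := by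
        rw [lintegral_prod _ hGa]
    _ ≤ (C : ℝ≥0∞) ^ (2 / 3 : ℝ) * (Kc ^ 2 * C) := by gcongr

/-- The `L^{10/3}` period constant is finite. [folklore] -/
theorem tenThirds_period_const_lt_top (C : ℝ≥0) :
    (C : ℝ≥0∞) ^ (2 / 3 : ℝ) *
        ((SNormLESNormFDerivOfEqConst (EuclideanSpace ℝ (Fin 3))
            (volume : Measure (EuclideanSpace ℝ (Fin 3))) 2 : ℝ≥0∞) ^ 2 * C) < ⊤ :=
  ENNReal.mul_lt_top (ENNReal.rpow_lt_top_of_nonneg (by norm_num) ENNReal.coe_ne_top)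
    (ENNReal.mul_lt_top (ENNReal.pow_lt_top ENNReal.coe_lt_top) ENNReal.coe_lt_top)

/-- **Slab classes from one period**: a jointly measurable `T`-periodic field with
`∫∫_{(0,T)×ℝ³} |U|^{10/3} < ∞` lies in `L^{10/3}([a,b] × ℝ³)` for all `a, b` (the slab is covered
by finitely many periods). [folklore] -/
theorem memLp_slab_tenThirds (hT : 0 < T) (hUm : AEStronglyMeasurable (uncurry U) volume)
    (hUper : ∀ s y, U (s + T) y = U s y)
    (hfin : ∫⁻ z in Ioo 0 T ×ˢ (univ : Set (EuclideanSpace ℝ (Fin 3))),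
      ‖U z.1 z.2‖ₑ ^ (10 / 3 : ℝ) ≠ ⊤) (a b : ℝ) :
    MemLp (uncurry U) (10 / 3)
      (volume.restrict (Icc a b ×ˢ (univ : Set (EuclideanSpace ℝ (Fin 3))))) := by
  refine ⟨hUm.restrict, (eLpNorm_lt_top_iff_lintegral_rpow_enorm_lt_top ten_thirds_ne_zero
    ten_thirds_ne_top).2 ?_⟩
  rw [toReal_ten_thirds]
  calc ∫⁻ z in Icc a b ×ˢ (univ : Set (EuclideanSpace ℝ (Fin 3))), ‖uncurry U z‖ₑ ^ (10 / 3 : ℝ)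
      ≤ ∫⁻ z in Ioo (a - 1) (b + 1) ×ˢ (univ : Set (EuclideanSpace ℝ (Fin 3))),
          ‖U z.1 z.2‖ₑ ^ (10 / 3 : ℝ) :=
        lintegral_mono_set (prod_mono (Icc_subset_Ioo (by linarith) (by linarith)) Subset.rfl)
    _ ≤ 2 * (⌈(b + 1 - (a - 1)) / T⌉₊ + 1 : ℕ) *
          ∫⁻ z in Ioo 0 T ×ˢ (univ : Set (EuclideanSpace ℝ (Fin 3))), ‖U z.1 z.2‖ₑ ^ (10 / 3 : ℝ) :=
        setLIntegral_Ioo_prod_le_of_periodic hT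
          (f := fun z : ℝ × EuclideanSpace ℝ (Fin 3) => ‖U z.1 z.2‖ₑ ^ (10 / 3 : ℝ))
          (fun s y => by simp only [hUper s y]) _ _
    _ < ⊤ := ENNReal.mul_lt_top (ENNReal.mul_lt_top (by simp) (ENNReal.natCast_lt_top _))
        hfin.lt_top

end TenThirds

/-! ### The profile -/

section Profile

variable {T : ℝ} {q : ℝ≥0∞} {α : ℝ} {W : ℝ → EuclideanSpace ℝ (Fin 3) → EuclideanSpace ℝ (Fin 3)}

/-- **Slab classes of the revised profile**: `W ∈ L^{10/3}([a,b] × ℝ³)` for all `a, b`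
(continuity and `‖W(s)‖_{L^{10/3}} ≤ α` for every `s`). [cite: BradshawTsai2017AHP, Lemma 2.5 (‖W‖_{L^∞(0,T;L^q)} ≤ α)] -/
theorem memLp_slab_profile (hW : IsRevisedProfile T (10 / 3) α W) (a b : ℝ) :
    MemLp (uncurry W) (10 / 3)
      (volume.restrict (Icc a b ×ˢ (univ : Set (EuclideanSpace ℝ (Fin 3))))) :=
  memLp_slab_of_forall_eLpNorm_le hW.contDiff.continuous.aestronglyMeasurable ten_thirds_ne_zero
    ten_thirds_ne_top ENNReal.ofReal_ne_top hW.small a b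

/-- **`∫∫_{I×ℝ³} |W|^{10/3} ≤ |I| α^{10/3}`** for the revised profile (`‖W(s)‖_{10/3} ≤ α` for
every `s`; Tonelli). [cite: BradshawTsai2017AHP, Lemma 2.5 and proof of Thm 2.4 ("C‖W‖²_{L^{10/3}(ℝ³×[0,T])} … finite")] -/
theorem lintegral_slab_profile_le (hW : IsRevisedProfile T (10 / 3) α W) (I : Set ℝ) :
    ∫⁻ z in I ×ˢ (univ : Set (EuclideanSpace ℝ (Fin 3))), ‖W z.1 z.2‖ₑ ^ (10 / 3 : ℝ) ≤
      volume I * ENNReal.ofReal α ^ (10 / 3 : ℝ) := by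
  have hWm : AEStronglyMeasurable (uncurry W) (volume : Measure (ℝ × EuclideanSpace ℝ (Fin 3))) :=
    hW.contDiff.continuous.aestronglyMeasurable
  have hprod := volume_restrict_prod_univ I
  have hWa : AEMeasurable (fun z : ℝ × EuclideanSpace ℝ (Fin 3) => ‖W z.1 z.2‖ₑ ^ (10 / 3 : ℝ))
      (((volume : Measure ℝ).restrict I).prod (volume : Measure (EuclideanSpace ℝ (Fin 3)))) := by
    rw [← hprod]; exact hWm.restrict.enorm.pow_const _
  -- slice bound: `∫ |W(s)|^{10/3} = ‖W(s)‖_{10/3}^{10/3} ≤ α^{10/3}`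
  have hslice : ∀ s, ∫⁻ y, ‖W s y‖ₑ ^ (10 / 3 : ℝ) ≤ ENNReal.ofReal α ^ (10 / 3 : ℝ) := by
    intro s
    have h := hW.small s
    have e : ∫⁻ y, ‖W s y‖ₑ ^ (10 / 3 : ℝ) = eLpNorm (W s) (10 / 3) volume ^ (10 / 3 : ℝ) := by
      rw [eLpNorm_eq_lintegral_rpow_enorm_toReal ten_thirds_ne_zero ten_thirds_ne_top, toReal_ten_thirds,
        ← ENNReal.rpow_mul, one_div, inv_mul_cancel₀ (by norm_num : (10 / 3 : ℝ) ≠ 0),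
        ENNReal.rpow_one]
    rw [e]
    exact ENNReal.rpow_le_rpow h (by norm_num)
  rw [hprod]
  calc ∫⁻ z, ‖W z.1 z.2‖ₑ ^ (10 / 3 : ℝ)
        ∂(((volume : Measure ℝ).restrict I).prod (volume : Measure (EuclideanSpace ℝ (Fin 3))))
      = ∫⁻ s in I, ∫⁻ y, ‖W s y‖ₑ ^ (10 / 3 : ℝ) := lintegral_prod _ hWa
    _ ≤ ∫⁻ _s in I, ENNReal.ofReal α ^ (10 / 3 : ℝ) :=
        lintegral_mono fun s => hslice s
    _ = volume I * ENNReal.ofReal α ^ (10 / 3 : ℝ) := by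
        rw [lintegral_const, Measure.restrict_apply_univ, mul_comm]

end Profile

/-! ### The mollified drift `η_ε * U` -/

section Drift

variable {T : ℝ} {U : ℝ → EuclideanSpace ℝ (Fin 3) → EuclideanSpace ℝ (Fin 3)}
  {η : EuclideanSpace ℝ (Fin 3) → ℝ} {ε : ℝ}

/-- The mollified drift of a `T`-periodic field is `T`-periodic. [folklore] -/
theorem mollify_add_period (hUper : ∀ s y, U (s + T) y = U s y) (s : ℝ)
    (y : EuclideanSpace ℝ (Fin 3)) : mollify η ε U (s + T) y = mollify η ε U s y := by
  have h : U (s + T) = U s := funext (hUper s)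
  simp only [mollify, h]

/-- The scaled kernel `η_ε` of a mollifying kernel is smooth. [folklore] -/
theorem IsMollifyingKernel.contDiff_scaledMollifier (hη : IsMollifyingKernel η) (ε : ℝ) :
    ContDiff ℝ (⊤ : ℕ∞) (BradshawTsai2019.scaledMollifier η ε) := by
  have e : BradshawTsai2019.scaledMollifier η ε =
      fun y => (ε ^ finrank ℝ (EuclideanSpace ℝ (Fin 3)))⁻¹ * η (ε⁻¹ • y) := rfl
  rw [e]
  exact contDiff_const.mul (hη.contDiff.comp (contDiff_const_smul _))

/-- The scaled kernel `η_ε`, `ε > 0`, of a mollifying kernel has compact support. [folklore] -/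
theorem IsMollifyingKernel.hasCompactSupport_scaledMollifier (hη : IsMollifyingKernel η)
    (hε : 0 < ε) : HasCompactSupport (BradshawTsai2019.scaledMollifier η ε) := by
  obtain ⟨ρ, -, hρ⟩ := hη.exists_support_radius
  exact BradshawTsai2019.hasCompactSupport_scaledMollifier hρ hε

/-- The scaled kernel `η_ε` is in every `L^p`. [folklore] -/
theorem IsMollifyingKernel.eLpNorm_scaledMollifier_lt_top (hη : IsMollifyingKernel η) (hε : 0 < ε)
    (p : ℝ≥0∞) : eLpNorm (BradshawTsai2019.scaledMollifier η ε) p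
      (volume : Measure (EuclideanSpace ℝ (Fin 3))) < ⊤ :=
  ((hη.continuous_scaledMollifier ε).memLp_of_hasCompactSupport (μ := volume)
    (hη.hasCompactSupport_scaledMollifier hε) (p := p)).eLpNorm_lt_top

/-- **Young's inequality for the mollified drift on a time slab**: for `1 ≤ q`, a jointly
measurable `U` and any `I ⊆ ℝ`, `∫∫_{I×ℝ³} |η_ε * U|^q ≤ ‖η‖₁^q ∫∫_{I×ℝ³} |U|^q` (Tonelli and
the slice-wise Young inequality). [folklore] -/
theorem lintegral_slab_mollify_rpow_le (hη : IsMollifyingKernel η) (hε : 0 < ε)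
    (hUm : AEStronglyMeasurable (uncurry U) volume) (I : Set ℝ) {q : ℝ} (hq : 1 ≤ q) :
    ∫⁻ z in I ×ˢ (univ : Set (EuclideanSpace ℝ (Fin 3))), ‖mollify η ε U z.1 z.2‖ₑ ^ q ≤
      (∫⁻ y, ‖η y‖ₑ) ^ q *
        ∫⁻ z in I ×ˢ (univ : Set (EuclideanSpace ℝ (Fin 3))), ‖U z.1 z.2‖ₑ ^ q := by
  have hmm : AEStronglyMeasurable (uncurry (mollify η ε U))
      (volume : Measure (ℝ × EuclideanSpace ℝ (Fin 3))) := hη.aestronglyMeasurable_mollify ε hUm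
  have hslice := ae_aestronglyMeasurable_slice hUm
  have hprod := volume_restrict_prod_univ I
  have hm1 : AEMeasurable (fun z : ℝ × EuclideanSpace ℝ (Fin 3) => ‖mollify η ε U z.1 z.2‖ₑ ^ q)
      (((volume : Measure ℝ).restrict I).prod (volume : Measure (EuclideanSpace ℝ (Fin 3)))) := by
    rw [← hprod]; exact hmm.restrict.enorm.pow_const q
  have hm2 : AEMeasurable (fun z : ℝ × EuclideanSpace ℝ (Fin 3) => ‖U z.1 z.2‖ₑ ^ q)
      (((volume : Measure ℝ).restrict I).prod (volume : Measure (EuclideanSpace ℝ (Fin 3)))) := by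
    rw [← hprod]; exact hUm.restrict.enorm.pow_const q
  rw [hprod, lintegral_prod _ hm1, lintegral_prod _ hm2,
    ← lintegral_const_mul'' _ hm2.lintegral_prod_right']
  refine lintegral_mono_ae ?_
  filter_upwards [ae_restrict_of_ae hslice] with s hs
  exact lintegral_mollify_rpow_le hη hε hs hq

/-- **Slab classes of the mollified drift**: if `U ∈ L^q([a,b] × ℝ³)` for all `a, b`
(`1 ≤ q < ∞`), then so is `η_ε * U`. [folklore] -/
theorem memLp_slab_mollify (hη : IsMollifyingKernel η) (hε : 0 < ε)
    (hUm : AEStronglyMeasurable (uncurry U) volume) {q : ℝ≥0∞} (hq1 : 1 ≤ q) (hqt : q ≠ ⊤)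
    (hU : ∀ a b : ℝ, MemLp (uncurry U) q
      (volume.restrict (Icc a b ×ˢ (univ : Set (EuclideanSpace ℝ (Fin 3)))))) (a b : ℝ) :
    MemLp (uncurry (mollify η ε U)) q
      (volume.restrict (Icc a b ×ˢ (univ : Set (EuclideanSpace ℝ (Fin 3))))) := by
  have hq0 : q ≠ 0 := (zero_lt_one.trans_le hq1).ne'
  have hqr : 1 ≤ q.toReal := by
    have h := ENNReal.toReal_mono hqt hq1
    rwa [ENNReal.toReal_one] at h
  refine ⟨(hη.aestronglyMeasurable_mollify ε hUm).restrict,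
    (eLpNorm_lt_top_iff_lintegral_rpow_enorm_lt_top hq0 hqt).2 ?_⟩
  refine (lintegral_slab_mollify_rpow_le hη hε hUm (Icc a b) hqr).trans_lt ?_
  exact ENNReal.mul_lt_top (ENNReal.rpow_lt_top_of_nonneg (by positivity)
    hη.lintegral_enorm_lt_top.ne) (lintegral_rpow_enorm_lt_top_of_eLpNorm_lt_top hq0 hqt (hU a b).2)

/-- **The pointwise bound `|η_ε * U(s)|(y) ≤ ‖η_ε‖₂ ‖U(s)‖₂`** (Cauchy–Schwarz). [folklore] -/
theorem enorm_mollify_le (hη : IsMollifyingKernel η) {s : ℝ}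
    (hUs : AEStronglyMeasurable (U s) (volume : Measure (EuclideanSpace ℝ (Fin 3))))
    (y : EuclideanSpace ℝ (Fin 3)) :
    ‖mollify η ε U s y‖ₑ ≤ eLpNorm (BradshawTsai2019.scaledMollifier η ε) 2 volume *
      eLpNorm (U s) 2 volume :=
  enorm_convolution_lsmul_le (hη.continuous_scaledMollifier ε).aestronglyMeasurable hUs y

/-- **The uniform bound of the mollified drift in the energy class**: if `∫ |U(s)|² ≤ C` and
`U(s)` is measurable, then `|η_ε * U(s)|(y) ≤ (‖η_ε‖₂ C^{1/2}).toReal` for every `y` — a finite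
constant independent of `s` and `y` ("`η_ε * U_ε` is bounded"). [folklore] -/
theorem norm_mollify_le_of_energy (hη : IsMollifyingKernel η) (hε : 0 < ε) {C : ℝ≥0} {s : ℝ}
    (hUs : AEStronglyMeasurable (U s) (volume : Measure (EuclideanSpace ℝ (Fin 3))))
    (hE : ∫⁻ y, ‖U s y‖ₑ ^ 2 ≤ C) (y : EuclideanSpace ℝ (Fin 3)) :
    ‖mollify η ε U s y‖ ≤ (eLpNorm (BradshawTsai2019.scaledMollifier η ε) 2
      (volume : Measure (EuclideanSpace ℝ (Fin 3))) * (C : ℝ≥0∞) ^ (1 / 2 : ℝ)).toReal := by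
  have h2 : eLpNorm (U s) 2 volume ≤ (C : ℝ≥0∞) ^ (1 / 2 : ℝ) := by
    rw [eLpNorm_eq_lintegral_rpow_enorm_toReal two_ne_zero ENNReal.ofNat_ne_top]
    simp only [ENNReal.toReal_ofNat, ENNReal.rpow_ofNat]
    exact ENNReal.rpow_le_rpow hE (by norm_num)
  have h := (enorm_mollify_le (ε := ε) hη hUs y).trans (mul_le_mul' le_rfl h2)
  have hfin : eLpNorm (BradshawTsai2019.scaledMollifier η ε) 2
      (volume : Measure (EuclideanSpace ℝ (Fin 3))) * (C : ℝ≥0∞) ^ (1 / 2 : ℝ) ≠ ⊤ :=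
    ENNReal.mul_ne_top (hη.eLpNorm_scaledMollifier_lt_top hε 2).ne
      (ENNReal.rpow_ne_top_of_nonneg (by norm_num) ENNReal.coe_ne_top)
  rw [← ofReal_norm] at h
  exact (ENNReal.ofReal_le_iff_le_toReal hfin).1 h

/-- **The slices of the mollified drift are smooth** (`η_ε ∈ C_c^∞`, `U(s)` locally integrable).
[folklore] -/
theorem contDiff_mollify_slice (hη : IsMollifyingKernel η) (hε : 0 < ε) {s : ℝ}
    (hUs : LocallyIntegrable (U s) (volume : Measure (EuclideanSpace ℝ (Fin 3)))) {n : ℕ∞} :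
    ContDiff ℝ n (mollify η ε U s) :=
  ((hη.hasCompactSupport_scaledMollifier hε).contDiff_convolution_left _
    (hη.contDiff_scaledMollifier ε) hUs).of_le (by exact_mod_cast le_top)

/-- **The slices of the mollified drift are divergence free** when `U(s)` is locally integrable
and weakly divergence free (`div (η_ε * U) = η_ε * div U = 0` weakly). [folklore] -/
theorem divergence_mollify_eq_zero (hη : IsMollifyingKernel η) (hε : 0 < ε) {s : ℝ}
    (hUs : LocallyIntegrable (U s) (volume : Measure (EuclideanSpace ℝ (Fin 3))))
    (hdiv : IsWeaklyDivFree (U s)) (y : EuclideanSpace ℝ (Fin 3)) :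
    VectorCalculus.divergence (mollify η ε U s) y = 0 :=
  divergence_convolution_eq_zero (hη.contDiff_scaledMollifier ε)
    (hη.hasCompactSupport_scaledMollifier hε) hUs hdiv y

/-- The slices of the mollified drift are (classically) divergence free, as `IsDivFree`.
[folklore] -/
theorem isDivFree_mollify_slice (hη : IsMollifyingKernel η) (hε : 0 < ε) {s : ℝ}
    (hUs : LocallyIntegrable (U s) (volume : Measure (EuclideanSpace ℝ (Fin 3))))
    (hdiv : IsWeaklyDivFree (U s)) : VectorCalculus.IsDivFree (mollify η ε U s) := fun y =>
  divergence_mollify_eq_zero hη hε hUs hdiv y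

end Drift

end BradshawTsai2017

end Literature.Analysis.FluidPDE

end
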